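import Literature.MathematicalPhysics.StatisticalMechanics.PeriodicConfigurationSums

/-!
# Crux `ChessboardParticlePlanes.LjBilayerHcp` (stmt-AtomisticToContinuum-6710), line `Sketch`, stub S3
# `stub_energyIdentity` — the rod-picture energy identity

For a periodic configuration `B` of `ℝ³` whose periods have heights in `2cℤ` (`c ≠ 0`) and whose motif is
`F₀ ∪ F₁` with `F₀` at even heights `2cℤ` and `F₁` at odd heights `(2ℤ+1)c`, the total site energy
`∑_{x ∈ F} ∑_{y ∈ S, y ≠ x} V_LJ |x-y|` (`S = B.points`) splits species-wise: with `P_M := M + L`,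
`S = P_{F₀} ⊔ P_{F₁}` (disjoint by parity of the height), and for `x ∈ F₀`,
`{y ∈ S | y ≠ x} = {y ∈ P_{F₀} | y ≠ x} ⊔ P_{F₁}`; each in-species sum splits further into the pairs at
distance `< 3/2` and those at distance `≥ 3/2` (indicator split).  All sums are absolutely convergent
(`PeriodicConfiguration.summable_lennardJones_dist_three`, sub-families by `Summable.subtype` /
`Summable.comp_injective`, unions by `Summable.tsum_union_disjoint` or
`Summable.tsum_subtype_add_tsum_subtype_compl`, indicator split by `Summable.tsum_add`).  [folklore]
-/

noncomputable section

open scoped BigOperators Classical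

namespace Summit.AtomisticToContinuum.Crystallization.Theorems.LjBilayerHcpSketch

open Literature.MathematicalPhysics.StatisticalMechanics

local notation "E3" => EuclideanSpace ℝ (Fin 3)

/-- A sub-family (indexed by a subset) of a summable real family indexed by a set is summable
(`ℝ` is complete). [folklore] -/
theorem energyIdentity_summable_subset {f : E3 → ℝ} {s t : Set E3} (h : s ⊆ t)
    (ht : Summable (f ∘ (↑) : t → ℝ)) : Summable (f ∘ (↑) : s → ℝ) :=
  ht.comp_injective (Set.inclusion_injective h)

/-- **Parity of heights separates the species.** If all periods have heights in `2cℤ`, `F₀` sits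
at even heights `2cℤ` and `F₁` at odd heights `(2ℤ+1)c` (`c ≠ 0`), then the species point sets
`F₀ + L` and `F₁ + L` are disjoint. [folklore] -/
theorem energyIdentity_disjoint {c : ℝ} {L : Submodule ℤ E3} {F₀ F₁ : Finset E3} (hc : c ≠ 0)
    (hL : ∀ g ∈ L, ∃ k : ℤ, g 2 = 2 * c * (k : ℝ))
    (h0 : ∀ x ∈ F₀, ∃ k : ℤ, x 2 = 2 * c * (k : ℝ))
    (h1 : ∀ x ∈ F₁, ∃ k : ℤ, x 2 = (2 * (k : ℝ) + 1) * c) :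
    Disjoint {z : E3 | ∃ p ∈ F₀, ∃ g ∈ L, z = p + g} {z : E3 | ∃ p ∈ F₁, ∃ g ∈ L, z = p + g} := by
  refine Set.disjoint_left.2 ?_
  rintro z ⟨p, hp, g, hg, rfl⟩ ⟨q, hq, g', hg', heq⟩
  obtain ⟨k, hk⟩ := h0 p hp
  obtain ⟨k', hk'⟩ := hL g hg
  obtain ⟨m, hm⟩ := h1 q hq
  obtain ⟨m', hm'⟩ := hL g' hg'
  have h2 : (p + g) 2 = (q + g') 2 := by rw [heq]
  simp only [PiLp.add_apply] at h2
  rw [hk, hk', hm, hm'] at h2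
  have h3 : ((2 * k + 2 * k' : ℤ) : ℝ) * c = ((2 * m + 1 + 2 * m' : ℤ) : ℝ) * c := by
    push_cast
    linarith
  have h4 : (2 * k + 2 * k' : ℤ) = 2 * m + 1 + 2 * m' := by
    exact_mod_cast mul_right_cancel₀ hc h3
  omega

/-- **Per-site split.** If the point set is the disjoint union `P₀ ⊔ P₁` and `x ∈ P₀`, the
Lennard-Jones lattice sum at `x` is the near in-species part plus the far in-species part plus
the cross-species part (all absolutely convergent). [folklore] -/
theorem energyIdentity_site (B : PeriodicConfiguration 3) (x : E3) (P₀ P₁ : Set E3)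
    (hS : B.points = P₀ ∪ P₁) (hd : Disjoint P₀ P₁) (hx : x ∈ P₀) :
    ∑' y : {y : E3 // y ∈ B.points ∧ y ≠ x}, lennardJones (dist x y.1) =
      (∑' y : {y : E3 // y ∈ P₀ ∧ y ≠ x},
          if dist x y.1 < 3 / 2 then lennardJones (dist x y.1) else 0) +
      (∑' y : {y : E3 // y ∈ P₀ ∧ y ≠ x},
          if dist x y.1 < 3 / 2 then 0 else lennardJones (dist x y.1)) +
      (∑' y : {y : E3 // y ∈ P₁}, lennardJones (dist x y.1)) := by
  have hsum : Summable ((fun y => lennardJones (dist x y)) ∘ (↑) :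
      ↥{y : E3 | y ∈ B.points ∧ y ≠ x} → ℝ) :=
    B.summable_lennardJones_dist_three x
  have hx1 : x ∉ P₁ := Set.disjoint_left.1 hd hx
  have hset : {y : E3 | y ∈ B.points ∧ y ≠ x} = {y : E3 | y ∈ P₀ ∧ y ≠ x} ∪ P₁ := by
    ext y
    simp only [Set.mem_setOf_eq, Set.mem_union, hS]
    constructor
    · rintro ⟨h | h, hne⟩
      exacts [Or.inl ⟨h, hne⟩, Or.inr h]
    · rintro (⟨h, hne⟩ | h)
      exacts [⟨Or.inl h, hne⟩, ⟨Or.inr h, fun e => hx1 (e ▸ h)⟩]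
  have hd' : Disjoint {y : E3 | y ∈ P₀ ∧ y ≠ x} P₁ :=
    Set.disjoint_left.2 fun y hy hy1 => (Set.disjoint_left.1 hd hy.1) hy1
  have hs0 : Summable ((fun y => lennardJones (dist x y)) ∘ (↑) :
      ↥{y : E3 | y ∈ P₀ ∧ y ≠ x} → ℝ) :=
    energyIdentity_summable_subset (hset ▸ Set.subset_union_left) hsum
  have hs1 : Summable ((fun y => lennardJones (dist x y)) ∘ (↑) : ↥P₁ → ℝ) :=
    energyIdentity_summable_subset (hset ▸ Set.subset_union_right) hsum
  have e1 : ∑' y : {y : E3 // y ∈ B.points ∧ y ≠ x}, lennardJones (dist x y.1) =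
      ∑' y : ↥({y : E3 | y ∈ P₀ ∧ y ≠ x} ∪ P₁), lennardJones (dist x y.1) :=
    (tsum_congr_set_coe (fun y => lennardJones (dist x y)) hset :)
  have e2 : ∑' y : ↥({y : E3 | y ∈ P₀ ∧ y ≠ x} ∪ P₁), lennardJones (dist x y.1) =
      (∑' y : {y : E3 // y ∈ P₀ ∧ y ≠ x}, lennardJones (dist x y.1)) +
        ∑' y : {y : E3 // y ∈ P₁}, lennardJones (dist x y.1) :=
    (hs0.tsum_union_disjoint (f := fun y => lennardJones (dist x y)) hd' hs1 :)
  have hnear : Summable (fun y : {y : E3 // y ∈ P₀ ∧ y ≠ x} =>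
      if dist x y.1 < 3 / 2 then lennardJones (dist x y.1) else 0) :=
    hs0.summable_of_eq_zero_or_self fun y => by
      by_cases h : dist x y.1 < 3 / 2
      · exact Or.inr (by simp [h, Function.comp])
      · exact Or.inl (by simp [h])
  have hfar : Summable (fun y : {y : E3 // y ∈ P₀ ∧ y ≠ x} =>
      if dist x y.1 < 3 / 2 then 0 else lennardJones (dist x y.1)) :=
    hs0.summable_of_eq_zero_or_self fun y => by
      by_cases h : dist x y.1 < 3 / 2
      · exact Or.inl (by simp [h])
      · exact Or.inr (by simp [h, Function.comp])
  have e3 : ∑' y : {y : E3 // y ∈ P₀ ∧ y ≠ x}, lennardJones (dist x y.1) =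
      (∑' y : {y : E3 // y ∈ P₀ ∧ y ≠ x},
          if dist x y.1 < 3 / 2 then lennardJones (dist x y.1) else 0) +
      (∑' y : {y : E3 // y ∈ P₀ ∧ y ≠ x},
          if dist x y.1 < 3 / 2 then 0 else lennardJones (dist x y.1)) := by
    rw [← hnear.tsum_add hfar]
    exact tsum_congr fun y => by split_ifs <;> simp
  rw [e1, e2, e3]

/-- **S3, rod-picture energy identity.** [folklore] -/
theorem stub_energyIdentity :
    ∀ (c : ℝ) (B : PeriodicConfiguration 3) (F₀ F₁ : Finset E3), c ≠ 0 →
      (∀ g ∈ B.lattice, ∃ k : ℤ, g 2 = 2 * c * (k : ℝ)) →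
      B.motif = F₀ ∪ F₁ →
      (∀ x ∈ F₀, ∃ k : ℤ, x 2 = 2 * c * (k : ℝ)) →
      (∀ x ∈ F₁, ∃ k : ℤ, x 2 = (2 * (k : ℝ) + 1) * c) →
      ∑ x ∈ B.motif, ∑' y : {y : E3 // y ∈ B.points ∧ y ≠ x}, lennardJones (dist x y.1) =
        (∑ x ∈ F₀,
          ((∑' y : {y : E3 // y ∈ {z : E3 | ∃ p ∈ F₀, ∃ g ∈ B.lattice, z = p + g} ∧ y ≠ x},
              if dist x y.1 < 3 / 2 then lennardJones (dist x y.1) else 0) +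
           (∑' y : {y : E3 // y ∈ {z : E3 | ∃ p ∈ F₀, ∃ g ∈ B.lattice, z = p + g} ∧ y ≠ x},
              if dist x y.1 < 3 / 2 then 0 else lennardJones (dist x y.1)) +
           (∑' y : {y : E3 // y ∈ {z : E3 | ∃ p ∈ F₁, ∃ g ∈ B.lattice, z = p + g}},
              lennardJones (dist x y.1)))) +
        (∑ x ∈ F₁,
          ((∑' y : {y : E3 // y ∈ {z : E3 | ∃ p ∈ F₁, ∃ g ∈ B.lattice, z = p + g} ∧ y ≠ x},
              if dist x y.1 < 3 / 2 then lennardJones (dist x y.1) else 0) +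
           (∑' y : {y : E3 // y ∈ {z : E3 | ∃ p ∈ F₁, ∃ g ∈ B.lattice, z = p + g} ∧ y ≠ x},
              if dist x y.1 < 3 / 2 then 0 else lennardJones (dist x y.1)) +
           (∑' y : {y : E3 // y ∈ {z : E3 | ∃ p ∈ F₀, ∃ g ∈ B.lattice, z = p + g}},
              lennardJones (dist x y.1)))) := by
  intro c B F₀ F₁ hc hL hmotif h0 h1
  set P₀ : Set E3 := {z : E3 | ∃ p ∈ F₀, ∃ g ∈ B.lattice, z = p + g} with hP₀
  set P₁ : Set E3 := {z : E3 | ∃ p ∈ F₁, ∃ g ∈ B.lattice, z = p + g} with hP₁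
  have hdisj : Disjoint P₀ P₁ := energyIdentity_disjoint hc hL h0 h1
  have hS : B.points = P₀ ∪ P₁ := by
    ext z
    simp only [PeriodicConfiguration.points, hmotif, Finset.mem_union, Set.mem_setOf_eq,
      Set.mem_union, hP₀, hP₁]
    constructor
    · rintro ⟨y, hy | hy, g, hg, rfl⟩
      · exact Or.inl ⟨y, hy, g, hg, rfl⟩
      · exact Or.inr ⟨y, hy, g, hg, rfl⟩
    · rintro (⟨y, hy, g, hg, rfl⟩ | ⟨y, hy, g, hg, rfl⟩)
      · exact ⟨y, Or.inl hy, g, hg, rfl⟩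
      · exact ⟨y, Or.inr hy, g, hg, rfl⟩
  have hx0 : ∀ x ∈ F₀, x ∈ P₀ := fun x hx => ⟨x, hx, 0, B.lattice.zero_mem, (add_zero x).symm⟩
  have hx1 : ∀ x ∈ F₁, x ∈ P₁ := fun x hx => ⟨x, hx, 0, B.lattice.zero_mem, (add_zero x).symm⟩
  have hF : Disjoint F₀ F₁ :=
    Finset.disjoint_left.2 fun x hx0' hx1' => Set.disjoint_left.1 hdisj (hx0 x hx0') (hx1 x hx1')
  rw [hmotif, Finset.sum_union hF]
  congr 1
  · exact Finset.sum_congr rfl fun x hx => energyIdentity_site B x P₀ P₁ hS hdisj (hx0 x hx)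
  · exact Finset.sum_congr rfl fun x hx =>
      energyIdentity_site B x P₁ P₀ (hS.trans (Set.union_comm _ _)) hdisj.symm (hx1 x hx)

end Summit.AtomisticToContinuum.Crystallization.Theorems.LjBilayerHcpSketch

end
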